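import Summits.BirchSwinnertonDyer.BirchSwinnertonDyer.Theses.NormCapitulation
import Summits.BirchSwinnertonDyer.BirchSwinnertonDyer.Theorems.ShadowIsolationShaCotorsionReducibleOfThesis

/-!
# BirchSwinnertonDyer / NormCapitulation — the Eisenstein crux `R = ShaCotorsionReducible`
# (stmt-BirchSwinnertonDyer-15277) is REDUNDANT among the hypotheses of the route's `closes`

Crux-strategist s1 of stmt-BirchSwinnertonDyer-15277 (route `NormCapitulation`, rev 10). The deciding
theorem of the route is `closes : UniversalNorm → PhantomCapitulation → NormHerbrandBound →
CapitulationSqueeze → SelmerRankUB → SelmerRankLB → SelmerRankSmallImage → ShaCotorsionReducible →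
Assembly → BirchSwinnertonDyer`, and `R = ShaCotorsionReducible` (at a good ordinary `p ≥ 5` with `E[p]`
REDUCIBLE, `corank_{ℤ_p} Ш(E/ℚ)[p^∞] = 0`) is its "one remaining hard crux" (lead c4 stalled on the
Eisenstein-depth line). This file proves, sorry-free over the route file and landed tree theorems, that
`R` FOLLOWS from the seven OTHER non-assembly hypotheses of `closes` — exactly as lead c3 showed for the
sister route `ShadowIsolation` (`Theorems/ShadowIsolationClosesWithoutR.lean`):

  given `W` (globally minimal, elliptic) and an Eisenstein good ordinary `p ≥ 5`, pick an auxiliary good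
  ordinary `q ≥ 5` with `E[q]` irreducible (PROVED supply
  `WeierstrassCurve.exists_gt_mem_goodOrdinaryPrimes_hasIrreducibleModPGaloisRep`, AEC Cor. IX.6.3 +
  infinitely many good ordinary primes); at `q` the route's JUNCTION (`UniversalNorm` ⇒ Heegner field,
  anticyclotomic tower and universal-norm datum; `NormHerbrandBound` ⇒ bounded capitulation kernel;
  `PhantomCapitulation`; `CapitulationSqueeze`) gives `corank Ш[q^∞] = 0`, and the image dichotomy
  (`SelmerRankUB ∧ SelmerRankLB` if `ρ̄_{E,q}` is surjective, `SelmerRankSmallImage` otherwise) gives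
  `corank Sel_{q^∞} = r_an`; Greenberg's identity at `q` (`corank Sel = rank + corank Ш`, tree theorem
  `WeierstrassCurve.selmerCorank_eq_mordellWeilRank_add_holds`) gives `rank E(ℚ) = r_an`;
  `SelmerRankSmallImage` at `p` (reducible ⇒ not surjective) gives `corank Sel_{p^∞} = r_an = rank`, and
  Greenberg's identity at `p` gives `corank Ш[p^∞] = 0`.

Consequences (standard axioms only):
* `normCapitulation_shaCotorsion_of_junction` — the junction as a stand-alone implication
  `UniversalNorm → PhantomCapitulation → NormHerbrandBound → CapitulationSqueeze →
   (Ш[p^∞]-cotorsion at every good ordinary irreducible p ≥ 5)` (the `by_cases hirr` branch of `closes`);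
* `normCapitulation_shaCotorsionReducible_of_items` — `UniversalNorm → PhantomCapitulation →
  NormHerbrandBound → CapitulationSqueeze → SelmerRankUB → SelmerRankLB → SelmerRankSmallImage →
  ShaCotorsionReducible`;
* `birchSwinnertonDyer_of_normCapitulation_items_without_shaCotorsionReducible` — the conclusion of
  `closes` from its hypotheses MINUS `hRed` (feeding the derived `R` back into `closes`).

PLANNER RECIPE (D-0014 note for the tenure planner, not a strategist action — a strategist never edits
`closes`): `ledger route edit route-BirchSwinnertonDyer-NormCapitulation --closes-file <glue>` with
`theorem closes (hUN) (hCap) (hHerb) (hSq) (hUB) (hLB) (hSI) (hA : Assembly) : BirchSwinnertonDyer :=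
birchSwinnertonDyer_of_normCapitulation_items_without_shaCotorsionReducible hUN hCap hHerb hSq hUB hLB hSI hA`
(or the inline proof below, which uses only the route's own vocabulary plus `ModPIrreducibleCofinite`),
and item stmt-15277 re-kinded `aside` on this route (BC6). The crux then keys no staffing here; as a
statement in its own right it stays wanted by whoever wants Ш-cotorsion at Eisenstein primes proved
DIRECTLY (strategist line `Cruxes/ShaCotorsionReducible/Lines/eisenstein_norm_capitulation.lean`).
-/

-- D-0017: single-problem summit, so `Summit.BirchSwinnertonDyer.BirchSwinnertonDyer.…` repeats a
-- namespace BY DESIGN.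
set_option linter.dupNamespace false

namespace Summit.BirchSwinnertonDyer.BirchSwinnertonDyer.Theorems

open Literature.NumberTheory.EllipticCurves
open Summit.BirchSwinnertonDyer.BirchSwinnertonDyer.Theses

/-- **The junction of route `NormCapitulation` as one implication.** `UniversalNorm →
PhantomCapitulation → NormHerbrandBound → CapitulationSqueeze →` (for every globally minimal elliptic
`V/ℚ` and every good ordinary `p ≥ 5` with `E[p]` irreducible, `shaCorank V p = 0`): `UniversalNorm`
supplies the Heegner field `K`, the anticyclotomic `ℤ_p`-extension `κ` and the universal-norm datum,
`NormHerbrandBound` turns the datum into a bounded capitulation kernel, `PhantomCapitulation` makes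
every infinitely `p`-divisible `p`-primary class of `Ш(E/K)` capitulate, `CapitulationSqueeze`
concludes. (Verbatim the irreducible branch of the route's `closes`.) [cite: Bertolini1995, Introduction]
[cite: Greenberg1999LNM, §1 pp. 54–57] -/
theorem normCapitulation_shaCotorsion_of_junction
    (hUN : NormCapitulation.UniversalNorm) (hCap : NormCapitulation.PhantomCapitulation)
    (hHerb : NormCapitulation.NormHerbrandBound) (hSq : NormCapitulation.CapitulationSqueeze) :
    ∀ (V : WeierstrassCurve ℚ) [V.IsElliptic] [V.IsGloballyMinimal] (p : ℕ) [Fact p.Prime],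
      5 ≤ p → V.HasGoodReductionAtPrime p → ¬ (p : ℤ) ∣ V.frobeniusTrace p →
      V.HasIrreducibleModPGaloisRep p → V.shaCorank p = 0 := by
  intro V _ _ p _ h5 hgood hord hirr
  obtain ⟨K, iK, iNK, hK, κ, hκ, hdatum⟩ := hUN V p h5 hgood hord hirr
  exact hSq V p h5 hgood hord hirr K hK κ hκ (hCap V p h5 hgood hord hirr K hK κ hκ)
    (hHerb V p h5 hgood hord hirr K hK κ hκ hdatum)

/-- **`R` from the route's seven other cruxes/supports.** `UniversalNorm → PhantomCapitulation →
NormHerbrandBound → CapitulationSqueeze → SelmerRankUB → SelmerRankLB → SelmerRankSmallImage →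
ShaCotorsionReducible`: at an auxiliary good ordinary prime `q ≥ 5` with `E[q]` irreducible (proved
supply `WeierstrassCurve.exists_gt_mem_goodOrdinaryPrimes_hasIrreducibleModPGaloisRep`, AEC Cor. IX.6.3)
the junction gives `corank Ш[q^∞] = 0` and the image dichotomy gives `corank Sel_{q^∞} = r_an`, so
Greenberg's identity at `q` gives `rank = r_an`; at the Eisenstein prime `p`, `SelmerRankSmallImage`
(reducible ⇒ `ρ̄_{E,p}` not surjective) gives `corank Sel_{p^∞} = r_an = rank` and Greenberg's identity
at `p` gives `corank Ш[p^∞] = 0`. [cite: Greenberg1999LNM, §1 pp. 54–57] [cite: SilvermanAEC2009, Cor. IX.6.3] -/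
theorem normCapitulation_shaCotorsionReducible_of_items
    (hUN : NormCapitulation.UniversalNorm) (hCap : NormCapitulation.PhantomCapitulation)
    (hHerb : NormCapitulation.NormHerbrandBound) (hSq : NormCapitulation.CapitulationSqueeze)
    (hUB : NormCapitulation.SelmerRankUB) (hLB : NormCapitulation.SelmerRankLB)
    (hSI : NormCapitulation.SelmerRankSmallImage) :
    NormCapitulation.ShaCotorsionReducible := by
  intro W _ _ p _ h5 hgood hord hred
  -- auxiliary good ordinary prime `q ≥ 5` with `E[q]` irreducible (proved supply)
  obtain ⟨q, h4q, ⟨hq, hqgood, hqord⟩, hqirr⟩ :=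
    WeierstrassCurve.exists_gt_mem_goodOrdinaryPrimes_hasIrreducibleModPGaloisRep W 4
  haveI := hq
  -- Ш-cotorsion at `q` by the junction, Selmer-rank BSD at `q` by the image dichotomy
  have hshaq : W.shaCorank q = 0 :=
    normCapitulation_shaCotorsion_of_junction hUN hCap hHerb hSq W q h4q hqgood hqord hqirr
  have hselq : W.selmerCorank q = W.analyticRank := by
    by_cases hsurj : W.HasSurjectiveModNGaloisRep q
    · exact le_antisymm (hUB W q h4q hqgood hqord hsurj) (hLB W q h4q hqgood hqord hsurj)
    · exact hSI W q h4q hqgood hqord hsurj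
  have hIdq : W.selmerCorank q = W.mordellWeilRank + W.shaCorank q :=
    W.selmerCorank_eq_mordellWeilRank_add_holds q
  -- Selmer-rank BSD at the Eisenstein prime `p` (small image) and Greenberg's identity at `p`
  have hselp : W.selmerCorank p = W.analyticRank :=
    hSI W p h5 hgood hord (not_hasSurjectiveModNGaloisRep_of_not_hasIrreducibleModPGaloisRep W p hred)
  have hIdp : W.selmerCorank p = W.mordellWeilRank + W.shaCorank p :=
    W.selmerCorank_eq_mordellWeilRank_add_holds p
  omega

/-- **The hypothesis of `Assembly` from the seven items.** `UniversalNorm → PhantomCapitulation →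
NormHerbrandBound → CapitulationSqueeze → SelmerRankUB → SelmerRankLB → SelmerRankSmallImage →`
(Selmer-rank BSD ∧ Ш[p^∞]-cotorsion at EVERY good ordinary `p ≥ 5` of every globally minimal elliptic
curve over `ℚ`) — the antecedent of the route's `Assembly` item: Selmer-rank BSD by the image dichotomy,
Ш-cotorsion by the junction at irreducible `p` and by `normCapitulation_shaCotorsionReducible_of_items`
at reducible `p`. This is the body the tenure planner's `closes` WITHOUT `hRed` should have. [cite: Greenberg1999LNM, §1 pp. 54–57] -/
theorem normCapitulation_assemblyHypothesis_of_items
    (hUN : NormCapitulation.UniversalNorm) (hCap : NormCapitulation.PhantomCapitulation)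
    (hHerb : NormCapitulation.NormHerbrandBound) (hSq : NormCapitulation.CapitulationSqueeze)
    (hUB : NormCapitulation.SelmerRankUB) (hLB : NormCapitulation.SelmerRankLB)
    (hSI : NormCapitulation.SelmerRankSmallImage) :
    ∀ (V : WeierstrassCurve ℚ) [V.IsElliptic] [V.IsGloballyMinimal] (p : ℕ) [Fact p.Prime],
      5 ≤ p → V.HasGoodReductionAtPrime p → ¬ (p : ℤ) ∣ V.frobeniusTrace p →
      (V.selmerCorank p = V.analyticRank ∧ V.shaCorank p = 0) := by
  intro V _ _ p _ h5 hgood hord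
  refine ⟨?_, ?_⟩
  · by_cases hsurj : V.HasSurjectiveModNGaloisRep p
    · exact le_antisymm (hUB V p h5 hgood hord hsurj) (hLB V p h5 hgood hord hsurj)
    · exact hSI V p h5 hgood hord hsurj
  · by_cases hirr : V.HasIrreducibleModPGaloisRep p
    · exact normCapitulation_shaCotorsion_of_junction hUN hCap hHerb hSq V p h5 hgood hord hirr
    · exact normCapitulation_shaCotorsionReducible_of_items hUN hCap hHerb hSq hUB hLB hSI V p h5 hgood
        hord hirr

/-- **The route's conclusion WITHOUT `R`.** `UniversalNorm → PhantomCapitulation → NormHerbrandBound →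
CapitulationSqueeze → SelmerRankUB → SelmerRankLB → SelmerRankSmallImage → Assembly →
BirchSwinnertonDyer`: the assembly item applied to `normCapitulation_assemblyHypothesis_of_items` —
the route's `closes` with its hypothesis `hRed : ShaCotorsionReducible` DERIVED from the other seven
(equivalently `NormCapitulation.closes hUN hCap hHerb hSq hUB hLB hSI (normCapitulation_shaCotorsionReducible_of_items …) hA`).
Hence item stmt-BirchSwinnertonDyer-15277 carries no weight in route `NormCapitulation`.
[cite: Greenberg1999LNM, §1 pp. 54–57] [cite: SilvermanAEC2009, Cor. IX.6.3] -/
theorem birchSwinnertonDyer_of_normCapitulation_items_without_shaCotorsionReducible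
    (hUN : NormCapitulation.UniversalNorm) (hCap : NormCapitulation.PhantomCapitulation)
    (hHerb : NormCapitulation.NormHerbrandBound) (hSq : NormCapitulation.CapitulationSqueeze)
    (hUB : NormCapitulation.SelmerRankUB) (hLB : NormCapitulation.SelmerRankLB)
    (hSI : NormCapitulation.SelmerRankSmallImage) (hA : NormCapitulation.Assembly) :
    _root_.BirchSwinnertonDyer :=
  hA (normCapitulation_assemblyHypothesis_of_items hUN hCap hHerb hSq hUB hLB hSI)

end Summit.BirchSwinnertonDyer.BirchSwinnertonDyer.Theorems
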